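import Literature.Barriers.CriticalPhenomena.AmenableInvariantPercolationProofs
import Literature.Barriers.CriticalPhenomena.AmenableInvariantPercolationBond
import Literature.Probability.Percolation.SiteConnectionTools
import Literature.Probability.LatticeModels.ThermodynamicLimit
import Literature.Probability.LatticeModels.GibbsEnergyBounds

/-!
# The barrier `AmenableInvariantPercolation` on `ℤ^d`, unconditionally

Barrier catalogue `Literature/Barriers/CriticalPhenomena/` (D-0021); second audit artifact
(2026-08-15) of `AmenableInvariantPercolationProofs.lean`. The catalogue entry
`AmenableInvariantPercolation` (Lyons–Peres 2016, Thm. 8.37, "amenable ⟹") is stated for an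
abstract connected, locally finite, transitive, amenable graph, and its specialisations to the
cubic lattice (`AmenableInvariantPercolation.z3`, `AmenableInvariantPercolationNarrow.z3`) carried
the three graph hypotheses — `(zdGraph 3).Connected`, `IsGraphTransitive (zdGraph 3)`,
`IsGraphAmenable (zdGraph 3)` — as assumptions ("amenability of `ℤ^d` is not proved here",
`scope_caveats:` of the entry). They are discharged here for every `d`, from tree material:

* `zdGraph_connected` — `ℤ^d` is connected (`zdGraph_preconnected_holds`, `LatticeGraph.lean`);
* `isGraphTransitive_zdGraph` — translations `zdShiftIso v` (`SiteConnectionTools.lean`) act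
  transitively [cite: LyonsPeres2016, §8.3 (transitive graphs)];
* `isGraphAmenable_zdGraph` — boxes are Følner sets: `|∂_E B(L)| / |B(L)| → 0`
  (`tendsto_card_edgeBoundary_box_div`, `GibbsEnergyBounds.lean`), i.e. `Φ_E(ℤ^d) = 0`
  ("the square lattice is edge amenable" [cite: LyonsPeres2016, §6.1]);

whence the barrier and its narrow (threshold) form hold on `ℤ^d` with no residual hypothesis:
`AmenableInvariantPercolation.zd`, `AmenableInvariantPercolationNarrow.zd` — on `ℤ³` no density
threshold below `1` valid for all automorphism-invariant site percolations forces an infinite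
cluster [cite: LyonsPeres2016, Thm. 8.37]; likewise the bond / expected-degree forms
(`AmenableInvariantPercolation_bond`, `AmenableInvariantPercolation_not_corollary_8_17` of
`AmenableInvariantPercolationBond.lean`): `AmenableInvariantPercolation_bond_zd` and
`AmenableInvariantPercolation_not_corollary_8_17_zd` — on `ℤ³` no expected-degree threshold
`6 - ε`, `ε > 0`, valid for all automorphism-invariant bond percolations with finite clusters
exists, i.e. the conclusion of [cite: LyonsPeres2016, Cor. 8.17] (the last step of the
uniqueness half of the BLPS proof of `θ(p_c) = 0`) fails on the cubic lattice
[cite: LyonsPeres2016, Exercise 8.58].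

## References

* R. Lyons, Y. Peres, *Probability on Trees and Networks*, CUP 2016, §6.1, §8.3, Thm. 8.16,
  Cor. 8.17, Thm. 8.37, Exercise 8.58. [LyonsPeres2016]
* S. Friedli, Y. Velenik, *Statistical Mechanics of Lattice Systems*, CUP 2017, §3.2.1 (boxes
  are a van Hove sequence). [FriedliVelenik2017]
-/

noncomputable section

namespace Literature.Barriers.CriticalPhenomena

open MeasureTheory Filter Topology Finset
open Literature.Probability.LatticeModels Literature.Probability.Percolation

/-! ### The three graph hypotheses for `ℤ^d` -/

/-- `ℤ^d` is connected. [cite: FriedliVelenik2017, §3.1] -/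
theorem zdGraph_connected (d : ℕ) : (zdGraph d).Connected :=
  (SimpleGraph.connected_iff _).2 ⟨zdGraph_preconnected_holds, ⟨0⟩⟩

/-- `ℤ^d` is vertex-transitive: the translation by `y - x` is an automorphism taking `x` to `y`.
[cite: LyonsPeres2016, §8.3 (transitive graphs)] -/
theorem isGraphTransitive_zdGraph (d : ℕ) : IsGraphTransitive (zdGraph d) := fun x y =>
  ⟨zdShiftIso (y - x), by rw [zdShiftIso_apply, add_sub_cancel]⟩

/-- `ℤ^d` is (edge-)amenable: the boxes `B(L) = [-L, L]^d` have `|∂_E B(L)| ≤ ε |B(L)|` for `L`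
large ("the square lattice is edge amenable"). [cite: LyonsPeres2016, §6.1]
[cite: FriedliVelenik2017, §3.2.1 (boxes are van Hove)] -/
theorem isGraphAmenable_zdGraph (d : ℕ) : IsGraphAmenable (zdGraph d) := by
  intro ε hε
  obtain ⟨L, hL⟩ := ((tendsto_card_edgeBoundary_box_div d).eventually (gt_mem_nhds hε)).exists
  have hne : (box d L).Nonempty := ⟨0, zero_mem_box d L⟩
  refine ⟨box d L, hne, ?_⟩
  have hpos : (0 : ℝ) < #(box d L) := by exact_mod_cast hne.card_pos
  exact ((div_lt_iff₀ hpos).1 hL).le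

/-! ### The barrier on `ℤ^d` with no residual hypothesis -/

/-- **Thm. 8.37 on `ℤ^d`**: for every `α < 1` the lattice `ℤ^d` carries an automorphism-invariant
site percolation with a.s. only finite clusters and one-site density `> α` everywhere.
[cite: LyonsPeres2016, Thm. 8.37] -/
theorem AmenableInvariantPercolation.zd (d : ℕ) {α : ℝ} (hα : α < 1) :
    ∃ μ : Measure (SiteConfig (Site d)), IsInvariantSitePercolation (zdGraph d) μ ∧
      (∀ᵐ ω ∂μ, ∀ x : Site d, (siteCluster (zdGraph d) ω x).Finite) ∧
      ∀ x : Site d, α < μ.real {ω | x ∈ ω} :=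
  AmenableInvariantPercolation_holds (zdGraph d) (zdGraph_connected d) (isGraphTransitive_zdGraph d)
    (isGraphAmenable_zdGraph d) α hα

/-- **No universal density threshold on `ℤ^d`** (threshold form of Thm. 8.37, cf.
`AmenableInvariantPercolationNarrow`): there is no `α < 1` such that every automorphism-invariant
site percolation on `ℤ^d` with a.s. finite clusters has density `≤ α` somewhere.
[cite: LyonsPeres2016, Thm. 8.37 (with Thm. 8.16 and Exercise 8.38)] -/
theorem AmenableInvariantPercolationNarrow.zd (d : ℕ) :
    ¬ ∃ α : ℝ, α < 1 ∧
        ∀ μ : Measure (SiteConfig (Site d)), IsInvariantSitePercolation (zdGraph d) μ →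
          (∀ᵐ ω ∂μ, ∀ x : Site d, (siteCluster (zdGraph d) ω x).Finite) →
            ∃ x : Site d, μ.real {ω | x ∈ ω} ≤ α :=
  AmenableInvariantPercolationNarrow AmenableInvariantPercolation_holds (zdGraph d)
    (zdGraph_connected d) (isGraphTransitive_zdGraph d) (isGraphAmenable_zdGraph d)

/-! ### Bond / expected-degree forms on `ℤ^d` -/

/-- **Exercise 8.58 on `ℤ^d`** (bond form): for every `α < 1` an automorphism-invariant bond
percolation on `ℤ^d`, supported on lattice edges, with a.s. finite clusters and all one-edge
marginals `> α`. [cite: LyonsPeres2016, Exercise 8.58] -/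
theorem AmenableInvariantPercolation_bond_zd (d : ℕ) {α : ℝ} (hα : α < 1) :
    ∃ ν : Measure (BondConfig (Site d)), IsInvariantBondPercolation (zdGraph d) ν ∧
      (∀ᵐ ξ ∂ν, ξ ⊆ (zdGraph d).edgeSet) ∧
      (∀ᵐ ξ ∂ν, ∀ x : Site d, (openCluster ξ x).Finite) ∧
      ∀ e ∈ (zdGraph d).edgeSet, α < ν.real {ξ | e ∈ ξ} :=
  AmenableInvariantPercolation_bond (zdGraph d) (zdGraph_connected d) (isGraphTransitive_zdGraph d)
    (isGraphAmenable_zdGraph d) α hα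

/-- **The conclusion of Cor. 8.17 fails on `ℤ^d`**: there is no `ε > 0` such that every
automorphism-invariant bond percolation on `ℤ^d` (supported on lattice edges) with a.s. finite
clusters has expected degree `≤ deg - ε` at some vertex — the threshold on which the uniqueness
half of the BLPS proof of `θ(p_c) = 0` rests is void on the cubic lattice.
[cite: LyonsPeres2016, Cor. 8.17 (with Thm. 8.21, proof, and Exercise 8.58)] -/
theorem AmenableInvariantPercolation_not_corollary_8_17_zd (d : ℕ) :
    ¬ ∃ ε : ℝ, 0 < ε ∧
        ∀ ν : Measure (BondConfig (Site d)), IsInvariantBondPercolation (zdGraph d) ν →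
          (∀ᵐ ξ ∂ν, ξ ⊆ (zdGraph d).edgeSet) →
            (∀ᵐ ξ ∂ν, ∀ x : Site d, (openCluster ξ x).Finite) →
              ∃ x : Site d, ∑ y ∈ (zdGraph d).neighborFinset x, ν.real {ξ | s(x, y) ∈ ξ} ≤
                (zdGraph d).degree x - ε :=
  AmenableInvariantPercolation_not_corollary_8_17 (zdGraph d) (zdGraph_connected d)
    (isGraphTransitive_zdGraph d) (isGraphAmenable_zdGraph d)

end Literature.Barriers.CriticalPhenomena

end
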